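import Literature.NumberTheory.GelbartRogawski1991.UnitaryDualPairThetaKernelCMTwistDet
import Literature.NumberTheory.GelbartRogawski1991.UnitaryDualPairThetaKernelCMKType
import Literature.NumberTheory.Automorphic.UnitaryGroupArchDet
import Literature.NumberTheory.Automorphic.UnitaryGroupArchIsotropy
import Literature.NumberTheory.Automorphic.UnitaryLineCharacters
import HarnessLib

-- buildfix G11b-3 recipe (LEDGER B13-1/B13-3): elaborate sequentially so the trailing `attribute [implicit_reducible]`
-- block (reducibilityCoreExt is keyed to the async environment branch) is in force at `.olean` export.
set_option Elab.async false

/-!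
# The normalising character `(χ_V ∘ det) ⊠ (χ_W ∘ det)` on the archimedean components

[GelbartRogawski1991, §3.1 Remark p. 457 L9–13]: the splittings of the metaplectic cover over a unitary group
differ by characters `ν′ ∘ det`, `ν′` an automorphic character of `E¹ = U(1)_{E/F}`. For the CM unitary dual
pair `U(V) × U(W)`, `V = diag dV`, `W = diag dW` over `L/L⁺`, the character of record of
`UnitaryDualPairThetaKernelCMTwistDet` is `η = (χ_V ∘ det_V) · (χ_W ∘ det_W)` with `χ_V, χ_W` unitary
characters of `[U(1)] = U(1)(L⁺)\U(1)(𝔸_{L⁺})` (`charOfUnitaryLineChar`). This file computes `η` on the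
ARCHIMEDEAN components [BorelJacquet1979, §4.1] (`g ↦ (g, 1)`), which is what a `K_∞`-type census consumes:

* `cmDetTwistChar_fst` / `cmDetTwistChar_snd` — `η (x, 1) = χ_V [det x]`, `η (1, y) = χ_W [det y]`;
* `cmAdelicDet_cmKTypeHom` — `det` is unchanged by the frame transport `x ↦ g_𝔸⁻¹ x g_𝔸 : U(H)(𝔸) → U(diag d)(𝔸)`
  (`cmKTypeHom`), so `det (cmKTypeHom x) = det x`;
* **`cmDetTwistChar_cmKTypeHom_archToAdelic`** — for `k ∈ U(H)(L ⊗ ℝ)`: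
  `η (g_𝔸⁻¹ (k, 1) g_𝔸, 1) = χ_V (cl (det_∞ k))`, `det_∞ k = cmArchDet L N H _ k ∈ U(1)(L⁺ ⊗ ℝ)` and
  `cl = relNormOneInfToQuot : U(1)(L⁺ ⊗ ℝ) → [U(1)]`; its `K_∞` special case
  **`cmDetTwistChar_cmKTypeHom_archIsotropyToAdelic`** (`k ∈ K_∞ = archIsotropy L H τ T hT`), also as an
  identity of homomorphisms `K_∞ →* ℂˣ` (`cmDetTwistChar_comp_archIsotropyToAdelic`);
* `cmDetTwistChar_one_archToAdelic` — the `U(W)`-side: `η (1, (t, 1)) = χ_W (cl (det_∞ t))` for `t ∈ U(diag dW)(L ⊗ ℝ)`;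
  and `cmDetTwistChar_archToAdelic_one` — the frame-free `U(V)`-side.

Consequently the `K_∞ × 1`-restriction of `η` has the archimedean type of `χ_V` composed with `det_∞`
(`HasArchType`, `UnitaryLineCharacters`) — the input of the weight census of the twisted splitting.
KERNEL ONLY: 0 records, 0 named facts, 0 sorry. Model-construction cell pub-hodgecm, node W2-Kn («K-norm»);
nothing here is a claim of the manuscripts adjudicated by that cell.
-/

set_option autoImplicit false

noncomputable section

open scoped Matrix
open NumberField Literature.NumberTheory.Automorphic

namespace Literature.NumberTheory.GelbartRogawski1991.UnitaryDualPair

variable (L : Type) [Field L] [NumberField L] [IsCMField L]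

/-! ## §1. `det` through a diagonal frame -/

section Frame

variable {N : ℕ} (H : Matrix (Fin N) (Fin N) L) (g : GL (Fin N) L) (d : Fin N → L)
  (hg : ((g : Matrix (Fin N) (Fin N) L).map (cmConjRingHom L))ᵀ * H * (g : Matrix (Fin N) (Fin N) L) =
    Matrix.diagonal d)

include hg

/-- a form congruent to `diag d` with all `dᵢ ≠ 0` is non-degenerate: `det H ≠ 0`. [folklore] -/
theorem det_ne_zero_of_frame (hd0 : ∀ i, d i ≠ 0) : H.det ≠ 0 := by
  intro hH
  have h := congrArg Matrix.det hg
  rw [Matrix.det_mul, Matrix.det_mul, hH, mul_zero, zero_mul, Matrix.det_diagonal] at h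
  exact (Finset.prod_ne_zero_iff.2 fun i _ => hd0 i) h.symm

/-- **`det (g_𝔸⁻¹ x g_𝔸) = det x`**: the frame transport `cmKTypeHom : U(H)(𝔸_{L⁺}) →* U(diag d)(𝔸_{L⁺})` does not
change the determinant in `U(1)(𝔸_{L⁺})`. [folklore] -/
theorem cmAdelicDet_cmKTypeHom (hd0 : ∀ i, d i ≠ 0) (hH : H.det ≠ 0)
    (x : ↥(UnitaryGroup.adelic (↥(maximalRealSubfield L)) L (IsCMField.complexConj L) N H)) :
    cmAdelicDet L d hd0 (cmKTypeHom L H g d hg x) =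
      UnitaryGroup.adelicDet (↥(maximalRealSubfield L)) L (IsCMField.complexConj L) N H hH x :=
  UnitaryGroup.adelicDet_eq_of_coe_eq_conj _ L _ N hH (det_diagonal_ne_zero L d hd0) x _ (toAdeleGL L g)
    (coe_cmKTypeHom L H g d hg x)

/-- **`det` of a transported archimedean element, in the torus currency**: for `k ∈ U(H)(L ⊗ ℝ)`,
`cmAdelicOneEquivRelNormOne (det (g_𝔸⁻¹ (k, 1) g_𝔸)) = (det_∞ k, 1) ∈ relNormOneIdeles L⁺ L`.
[cite: BorelJacquet1979, §4.1] -/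
theorem cmAdelicOneEquivRelNormOne_cmAdelicDet_cmKTypeHom_archToAdelic (hd0 : ∀ i, d i ≠ 0)
    (k : UnitaryGroup.arch (↥(maximalRealSubfield L)) L (IsCMField.complexConj L) N H) :
    UnitaryGroup.cmAdelicOneEquivRelNormOne L
        (cmAdelicDet L d hd0 (cmKTypeHom L H g d hg
          (UnitaryGroup.archToAdelic (↥(maximalRealSubfield L)) L (IsCMField.complexConj L) N H k))) =
      relNormOneInfToIdeles (↥(maximalRealSubfield L)) L
        (UnitaryGroup.cmArchDet L N H (det_ne_zero_of_frame L H g d hg hd0) k) := by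
  rw [cmAdelicDet_cmKTypeHom L H g d hg hd0 (det_ne_zero_of_frame L H g d hg hd0),
    UnitaryGroup.relNormOneInfToIdeles_cmArchDet]

end Frame

/-! ## §2. Values of `η = (χ_V ∘ det) ⊠ (χ_W ∘ det)` on archimedean components -/

section Value

variable {N M : ℕ} (dV : Fin N → L) (hdV0 : ∀ i, dV i ≠ 0) (dW : Fin M → L) (hdW0 : ∀ j, dW j ≠ 0)
variable (χV χW : ContinuousMonoidHom
  (relNormOneIdeles (↥(maximalRealSubfield L)) L ⧸ relNormOneRat (↥(maximalRealSubfield L)) L) Circle)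

/-- `η (x, 1) = χ_V [det x]`. [folklore] -/
theorem cmDetTwistChar_fst (x : CMAdelic L dV) :
    cmDetTwistChar L dV hdV0 dW hdW0 (charOfUnitaryLineChar L χV) (charOfUnitaryLineChar L χW) (x, 1) =
      Circle.toUnits (χV (QuotientGroup.mk
        (UnitaryGroup.cmAdelicOneEquivRelNormOne L (cmAdelicDet L dV hdV0 x)))) := by
  rw [cmDetTwistChar_apply, map_one, map_one, mul_one]
  rfl

/-- `η (1, y) = χ_W [det y]`. [folklore] -/
theorem cmDetTwistChar_snd (y : CMAdelic L dW) :
    cmDetTwistChar L dV hdV0 dW hdW0 (charOfUnitaryLineChar L χV) (charOfUnitaryLineChar L χW) (1, y) =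
      Circle.toUnits (χW (QuotientGroup.mk
        (UnitaryGroup.cmAdelicOneEquivRelNormOne L (cmAdelicDet L dW hdW0 y)))) := by
  rw [cmDetTwistChar_apply, map_one, map_one, one_mul]
  rfl

/-- **THE BRIDGE (`U(V)`-side, through a frame `ᵗḡ H g = diag dV`)**: for `k ∈ U(H)(L ⊗ ℝ)`,
`η (g_𝔸⁻¹ (k, 1) g_𝔸, 1) = χ_V (cl (det_∞ k))` with `det_∞ k = cmArchDet L N H _ k ∈ U(1)(L⁺ ⊗ ℝ)` and
`cl = relNormOneInfToQuot`. [cite: GelbartRogawski1991, §3.1 Remark p. 457 L9–13] -/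
theorem cmDetTwistChar_cmKTypeHom_archToAdelic (H : Matrix (Fin N) (Fin N) L) (g : GL (Fin N) L)
    (hg : ((g : Matrix (Fin N) (Fin N) L).map (cmConjRingHom L))ᵀ * H * (g : Matrix (Fin N) (Fin N) L) =
      Matrix.diagonal dV)
    (k : UnitaryGroup.arch (↥(maximalRealSubfield L)) L (IsCMField.complexConj L) N H) :
    cmDetTwistChar L dV hdV0 dW hdW0 (charOfUnitaryLineChar L χV) (charOfUnitaryLineChar L χW)
        (cmKTypeHom L H g dV hg
          (UnitaryGroup.archToAdelic (↥(maximalRealSubfield L)) L (IsCMField.complexConj L) N H k), 1) =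
      Circle.toUnits (χV (relNormOneInfToQuot (↥(maximalRealSubfield L)) L
        (UnitaryGroup.cmArchDet L N H (det_ne_zero_of_frame L H g dV hg hdV0) k))) := by
  rw [cmDetTwistChar_fst, cmAdelicOneEquivRelNormOne_cmAdelicDet_cmKTypeHom_archToAdelic,
    relNormOneInfToQuot_apply]

/-- **the frame-free `U(V)`-side**: for `x ∈ U(diag dV)(L ⊗ ℝ)`, `η ((x, 1), 1) = χ_V (cl (det_∞ x))`.
[cite: GelbartRogawski1991, §3.1 Remark p. 457 L9–13] -/
theorem cmDetTwistChar_archToAdelic_one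
    (x : UnitaryGroup.arch (↥(maximalRealSubfield L)) L (IsCMField.complexConj L) N (Matrix.diagonal dV)) :
    cmDetTwistChar L dV hdV0 dW hdW0 (charOfUnitaryLineChar L χV) (charOfUnitaryLineChar L χW)
        (UnitaryGroup.archToAdelic (↥(maximalRealSubfield L)) L (IsCMField.complexConj L) N
          (Matrix.diagonal dV) x, 1) =
      Circle.toUnits (χV (relNormOneInfToQuot (↥(maximalRealSubfield L)) L
        (UnitaryGroup.cmArchDet L N (Matrix.diagonal dV) (det_diagonal_ne_zero L dV hdV0) x))) := by
  rw [cmDetTwistChar_fst, relNormOneInfToQuot_apply, UnitaryGroup.relNormOneInfToIdeles_cmArchDet]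
  rfl

/-- **the `U(W)`-side**: for `t ∈ U(diag dW)(L ⊗ ℝ)`, `η (1, (t, 1)) = χ_W (cl (det_∞ t))`.
[cite: GelbartRogawski1991, §3.1 Remark p. 457 L9–13] -/
theorem cmDetTwistChar_one_archToAdelic
    (t : UnitaryGroup.arch (↥(maximalRealSubfield L)) L (IsCMField.complexConj L) M (Matrix.diagonal dW)) :
    cmDetTwistChar L dV hdV0 dW hdW0 (charOfUnitaryLineChar L χV) (charOfUnitaryLineChar L χW)
        (1, UnitaryGroup.archToAdelic (↥(maximalRealSubfield L)) L (IsCMField.complexConj L) M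
          (Matrix.diagonal dW) t) =
      Circle.toUnits (χW (relNormOneInfToQuot (↥(maximalRealSubfield L)) L
        (UnitaryGroup.cmArchDet L M (Matrix.diagonal dW) (det_diagonal_ne_zero L dW hdW0) t))) := by
  rw [cmDetTwistChar_snd, relNormOneInfToQuot_apply, UnitaryGroup.relNormOneInfToIdeles_cmArchDet]
  rfl

/-- **both components at once**: `η ((g_𝔸⁻¹ (k, 1) g_𝔸), (t, 1)) = χ_V (cl (det_∞ k)) · χ_W (cl (det_∞ t))`.
[cite: GelbartRogawski1991, §3.1 Remark p. 457 L9–13] -/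
theorem cmDetTwistChar_cmKTypeHom_archToAdelic_archToAdelic (H : Matrix (Fin N) (Fin N) L) (g : GL (Fin N) L)
    (hg : ((g : Matrix (Fin N) (Fin N) L).map (cmConjRingHom L))ᵀ * H * (g : Matrix (Fin N) (Fin N) L) =
      Matrix.diagonal dV)
    (k : UnitaryGroup.arch (↥(maximalRealSubfield L)) L (IsCMField.complexConj L) N H)
    (t : UnitaryGroup.arch (↥(maximalRealSubfield L)) L (IsCMField.complexConj L) M (Matrix.diagonal dW)) :
    cmDetTwistChar L dV hdV0 dW hdW0 (charOfUnitaryLineChar L χV) (charOfUnitaryLineChar L χW)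
        (cmKTypeHom L H g dV hg
          (UnitaryGroup.archToAdelic (↥(maximalRealSubfield L)) L (IsCMField.complexConj L) N H k),
         UnitaryGroup.archToAdelic (↥(maximalRealSubfield L)) L (IsCMField.complexConj L) M
          (Matrix.diagonal dW) t) =
      Circle.toUnits (χV (relNormOneInfToQuot (↥(maximalRealSubfield L)) L
          (UnitaryGroup.cmArchDet L N H (det_ne_zero_of_frame L H g dV hg hdV0) k))) *
        Circle.toUnits (χW (relNormOneInfToQuot (↥(maximalRealSubfield L)) L
          (UnitaryGroup.cmArchDet L M (Matrix.diagonal dW) (det_diagonal_ne_zero L dW hdW0) t))) := by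
  have h1 := cmDetTwistChar_cmKTypeHom_archToAdelic L dV hdV0 dW hdW0 χV χW H g hg k
  have h2 := cmDetTwistChar_one_archToAdelic L dV hdV0 dW hdW0 χV χW t
  rw [← h1, ← h2, ← map_mul, Prod.mk_mul_mk, mul_one, one_mul]

end Value

/-! ## §3. The `K_∞ × 1` restriction (what the `K_∞`-type census reads) -/

section KInf

variable (dV₃ : Fin 3 → L) (hdV₃ : ∀ i, dV₃ i ≠ 0) {M : ℕ} (dW : Fin M → L) (hdW0 : ∀ j, dW j ≠ 0)
variable (χV χW : ContinuousMonoidHom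
  (relNormOneIdeles (↥(maximalRealSubfield L)) L ⧸ relNormOneRat (↥(maximalRealSubfield L)) L) Circle)
variable (H : Matrix (Fin 3) (Fin 3) L) (g : GL (Fin 3) L)
  (hg : ((g : Matrix (Fin 3) (Fin 3) L).map (cmConjRingHom L))ᵀ * H * (g : Matrix (Fin 3) (Fin 3) L) =
    Matrix.diagonal dV₃)
  (τ : L →+* ℂ) (T : GL (Fin 3) ℂ)
  (hT : formCongr (starRingEnd ℂ) T (H.map τ) = Literature.Geometry.ComplexHyperbolic.BallModel.J)

/-- **the `K_∞` case** of the bridge: for `k ∈ K_∞ = archIsotropy L H τ T hT ≤ U(H)(L ⊗ ℝ)`,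
`η (g_𝔸⁻¹ (k, 1) g_𝔸, 1) = χ_V (cl (det_∞ k))`. [cite: GelbartRogawski1991, §3.1 Remark p. 457 L9–13] -/
theorem cmDetTwistChar_cmKTypeHom_archIsotropyToAdelic (k : UnitaryGroup.archIsotropy L H τ T hT) :
    cmDetTwistChar L dV₃ hdV₃ dW hdW0 (charOfUnitaryLineChar L χV) (charOfUnitaryLineChar L χW)
        (cmKTypeHom L H g dV₃ hg (UnitaryGroup.archIsotropyToAdelic L H τ T hT k), 1) =
      Circle.toUnits (χV (relNormOneInfToQuot (↥(maximalRealSubfield L)) L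
        (UnitaryGroup.cmArchDet L 3 H (det_ne_zero_of_frame L H g dV₃ hg hdV₃)
          (k : UnitaryGroup.arch (↥(maximalRealSubfield L)) L (IsCMField.complexConj L) 3 H)))) :=
  cmDetTwistChar_cmKTypeHom_archToAdelic L dV₃ hdV₃ dW hdW0 χV χW H g hg _

/-- the same as an identity of homomorphisms `K_∞ →* ℂˣ`:
`η ∘ (g_𝔸⁻¹ (·, 1) g_𝔸, 1) = toUnits ∘ χ_V ∘ cl ∘ det_∞ ∘ (K_∞ ↪ U(H)(L ⊗ ℝ))` — the `K_∞ × 1`-restriction of the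
normalising character is `χ_V ∘ det_∞` read in `[U(1)]`. [cite: GelbartRogawski1991, §3.1 Remark p. 457 L9–13] -/
theorem cmDetTwistChar_comp_archIsotropyToAdelic :
    (cmDetTwistChar L dV₃ hdV₃ dW hdW0 (charOfUnitaryLineChar L χV) (charOfUnitaryLineChar L χW)).comp
        (((cmKTypeHom L H g dV₃ hg).comp (UnitaryGroup.archIsotropyToAdelic L H τ T hT)).prod 1) =
      Circle.toUnits.comp ((χV : _ →* Circle).comp
        ((relNormOneInfToQuot (↥(maximalRealSubfield L)) L).comp
          ((UnitaryGroup.cmArchDet L 3 H (det_ne_zero_of_frame L H g dV₃ hg hdV₃)).comp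
            (UnitaryGroup.archIsotropy L H τ T hT).subtype))) := by
  refine MonoidHom.ext fun k => ?_
  simp only [MonoidHom.comp_apply, MonoidHom.prod_apply, MonoidHom.one_apply]
  exact cmDetTwistChar_cmKTypeHom_archIsotropyToAdelic L dV₃ hdV₃ dW hdW0 χV χW H g hg τ T hT k

/-- continuity of the `K_∞ × 1`-restriction's target map `k ↦ χ_V (cl (det_∞ k))`. [folklore] -/
theorem continuous_chi_relNormOneInfToQuot_cmArchDet :
    Continuous fun k : UnitaryGroup.archIsotropy L H τ T hT =>
      χV (relNormOneInfToQuot (↥(maximalRealSubfield L)) L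
        (UnitaryGroup.cmArchDet L 3 H (det_ne_zero_of_frame L H g dV₃ hg hdV₃)
          (k : UnitaryGroup.arch (↥(maximalRealSubfield L)) L (IsCMField.complexConj L) 3 H))) :=
  χV.continuous.comp ((continuous_relNormOneInfToQuot _ L).comp
    ((UnitaryGroup.continuous_cmArchDet L 3 H _).comp continuous_subtype_val))

end KInf

/-! ### Build-lane note (ops-buildfix G11b-3 recipe, LEDGER B13-1, 2026-08-21)
`lean -o` (the hub build lane, never `lean`/the gate check) runs Lean 4.32's library-suggestion indexers
(`Lean.LibrarySuggestions.SymbolFrequency` / `SineQuaNon`, from their `exportEntriesFn`) over the statement of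
every local theorem that is not a denied premise; on this family's statements (very large dependent binder
telescopes through the theta-kernel / dual-pair data) that fold runs for tens of minutes to hours and the build
lane kills the job (incident G11b-3, run/shared/lean/ops/buildfix/G11b-3-DOSSIER.md). `isDeniedPremise` skips
`[implicit_reducible]` constants before any fold, and a reducibility status on a *theorem* is inert (Meta never
unfolds `thmInfo`; the kernel ignores the attribute), so the public theorems of this file are tagged
`[implicit_reducible]` purely to keep them out of that index. Only other effect: they are not offered by
`+suggestions` premise selectors. No statement or proof is changed; superseded if the operator lands a
deny-list form (`HarnessLib.PremiseIndex`). -/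
set_option allowUnsafeReducibility true in
attribute [implicit_reducible]
  det_ne_zero_of_frame cmAdelicDet_cmKTypeHom
  cmAdelicOneEquivRelNormOne_cmAdelicDet_cmKTypeHom_archToAdelic cmDetTwistChar_fst
  cmDetTwistChar_snd cmDetTwistChar_cmKTypeHom_archToAdelic cmDetTwistChar_archToAdelic_one
  cmDetTwistChar_one_archToAdelic cmDetTwistChar_cmKTypeHom_archToAdelic_archToAdelic
  cmDetTwistChar_cmKTypeHom_archIsotropyToAdelic cmDetTwistChar_comp_archIsotropyToAdelic
  continuous_chi_relNormOneInfToQuot_cmArchDet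

end Literature.NumberTheory.GelbartRogawski1991.UnitaryDualPair

end
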